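import Summits.BirchSwinnertonDyer.BirchSwinnertonDyer.Theorems.ThetaPartnerAtTwoSignedKatoUpToAtTwoKatoBKLevelIdentity
import HarnessLib

/-!
# Crux `SupersingularRankZeroAtTwo` (K4, item stmt-BirchSwinnertonDyer-19097), line `odd_blind_package` v2.19, `stub_flatPackage`
# conjunct (8), F3 (the ♭ explicit reciprocity computation at `2`) — FILE E2: the `u`-GENERIC PER-LEVEL IDENTITY
# «`q_den · Σ_{j<2ⁿ} χ(5)ʲ ⟨s_n, gʲ d_n⟩ = u · q_num · R(χ) · ratTwistedSymbolSum f χ`» at a primitive (resp. the trivial) even character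

Seat `bsd-2adic-tower-1` GEN 69, hand «hF3-ERL» (pen GEN 41 SUMMON 20260831T215831Z, director-bsd (979) slot 2). HONEST FRAMING:
theorems only (no definition, no named fact, no instance, no `sorry`); every published/kernel input is a DISPLAYED hypothesis; helper
toward conjunct (8) F3 of `stub_flatPackage`; closes no stub and no item; 19097 OPEN; BSD₂ is proved for no supersingular curve and BSD for
no curve by any of this.

## What

K3's `SignedKatoOffTwo.KatoBK.level_identity_primitive` / `level_identity_trivial` (line `colemanrat`, a₂ = 0) glue, at one level `n` and
one even character `χ` modulo `2^{n+2}`, the (C6)-shaped pairing values `V j = Tr(L_j · E)`, the orbit of logarithms `L_j = g₀ʲ • L₀`, the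
LOG CHARACTER SUM «`Σ_{j<2ⁿ} ψ(5)ʲ L_j = 3·τ(ψ)`» and Kato's value law (B2) into
«`q.den · Σ_j V_j χ(5)ʲ = 3 q.num · R(χ) · ratTwistedSymbolSum f χ`». The constant `3` there is `#Ẽ(𝔽₂) = 3 − a₂` at `a₂ = 0` (the
normalisation of the plus Honda point `d_n = 3•(c_{n+2} + σ•c_{n+2}) − 2•c_1`). For the ♭ road at `a₂ ∈ {0, ±2}` the Sprung–Honda system of
`SSHondaTwo.sprungPrimal_padic` is `d_n = N₁•(y_{n+2} + σ•y_{n+2}) − 2•y_1` with `N₁ = 3 − a₂ ∈ {1, 3, 5}`, and the log character sum reads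
«`Σ_j ψ(5)ʲ L_j = u·τ(ψ)`» with `u = N₁`. This file is the SAME identity with the constant DISPLAYED:

* `flat_level_identity_primitive (u : ℚ) (hlogprim : ∀ ψ even primitive, Σ_j ψ(5)ʲ L_j = u * gaussSum ψ …) : q.den · Σ_j V_j χ(5)ʲ =
  u * q.num * R(χ) * ratTwistedSymbolSum f χ` — K3's theorem is the instance `u = 3`;
* `flat_level_identity_trivial (u : ℚ) (hB4c : Σ_b σ_b x = (u/2)·q·S₀·R) … : q.den · Σ_j V_j = u * q.num * R * ratTwistedSymbolSum f 1` — the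
  trivial character (base levels `n ≤ 1`), with the `{2}`-depleted factor `L_{(2)}(f,1)/L(f,1) = 1 − a₂/2 + 1/2 = u/2` displayed.

Proofs: K3's, verbatim up to the constant (the character transport `χ ↝ ψ ↝ ψ_F`, `KatoBK.sum_pow_mul_trace_eq_mul`,
`KatoBK.sum_mul_smul_algHom_eq`, `ratTwistedSymbolSum_ringHomComp`).

References: [Kobayashi2003] S. Kobayashi, Invent. Math. 152 (2003), Prop. 8.25–8.26 (pp. 24–25), proof of Thm. 6.3; [Kato2004Asterisque]
Thm. 6.6 (1), Thm. 9.7, Thm. 12.5 (1); [Sprung2012] F. Sprung, J. Number Theory 132 (2012), Thm. 2.2, Lemma 2.3, Props. 6.3–6.5;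
[MazurTateTeitelbaum1986Invent] §I.4 (4.2), §I.13.
-/

set_option autoImplicit false
-- the Theorems namespace of this sub repeats the summit name by design (D-0017 nested layout)
set_option linter.dupNamespace false

noncomputable section

set_option backward.isDefEq.respectTransparency false

open scoped Classical NumberField

namespace Summit.BirchSwinnertonDyer.BirchSwinnertonDyer.Theorems.SSFlatERL

open Field NumberField IsDedekindDomain Polynomial
  Literature.NumberTheory.GaloisRepresentations Literature.NumberTheory.EllipticCurves
  Literature.NumberTheory.EllipticCurves.Kato2004.EulerSystemValues
  Summit.BirchSwinnertonDyer.Rank1Residual.Additive.PadicCyclotomicTower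
  Summit.BirchSwinnertonDyer.BirchSwinnertonDyer.Theorems.SignedKatoOffTwo
  Summit.BirchSwinnertonDyer.BirchSwinnertonDyer.Theorems.SignedKatoOffTwo.KatoBK
  CongruenceSubgroup

/-! ## §1 The per-level identity at a PRIMITIVE character, `u`-generic -/

section Primitive

/-- **The ♭ level identity at a primitive character, `u`-generic** (K3's `KatoBK.level_identity_primitive` with the constant of the
log character sum DISPLAYED). Inputs: the (C6)-shaped pairing values `V j = Tr(L_j · E)` (`E = e(x)`), the orbit of logarithms
`L_j = g₀ʲ • L₀` of a point of `E(ℚ_{2,n})`, the log character sum «`Σ_j ψ(5)ʲ L_j = u·τ(ψ)`» (for the Sprung–Honda system at `2`: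
`u = #Ẽ(𝔽₂) = 3 − a₂`), Kato's value law at level `M = 2^{n+2}` in its algebraic currency (B2):
«`(Σ_b ψ_F⁻¹(b) σ_b x)·τ_F(ψ_F) = q·RTSS(ψ_F)·R_F(ψ_F)`». Conclusion, in `ℂ₂`, for the primitive even character `χ`:
`q.den · Σ_{j<2ⁿ} V_j χ(5)ʲ = u · q.num · R(χ) · ratTwistedSymbolSum f χ`. [cite: Kobayashi2003, Prop. 8.25–8.26 (pp. 24–25), proof of Thm. 6.3]
[cite: Kato2004Asterisque, Thm. 6.6 (1), Thm. 9.7, Thm. 12.5 (1)] [cite: Sprung2012, Thm. 2.2, Props. 6.3–6.5] -/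
theorem flat_level_identity_primitive {N : ℕ} [NeZero N] (f : CuspForm (Gamma0 N) 2)
    (n : ℕ) {M : ℕ} [NeZero M] (hM : M = 2 ^ (n + 2))
    (e : CyclotomicField M ℚ →ₐ[ℚ] PadicAlgCl 2)
    (he : e (IsCyclotomicExtension.zeta M ℚ (CyclotomicField M ℚ)) = zeta 2 (n + 2))
    (τ : ZMod (2 ^ (n + 2)) → Field.absoluteGaloisGroup ℚ_[2])
    (hτ : ∀ a : ZMod (2 ^ (n + 2)), IsUnit a → τ a • zeta 2 (n + 2) = zeta 2 (n + 2) ^ a.val)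
    {g₀ : Field.absoluteGaloisGroup ℚ_[2]} (hg₀ : ∀ j : ℕ, g₀ ^ j • zeta 2 (n + 2) = zeta 2 (n + 2) ^ 5 ^ j)
    (L : ℕ → PadicAlgCl 2) (hL : ∀ j, L j = g₀ ^ j • L 0) (hL0 : L 0 ∈ layer 2 (n + 2))
    (hLneg : ∀ a : ZMod (2 ^ (n + 2)), IsUnit a → τ (-a) • L 0 = τ a • L 0)
    (xF : CyclotomicField M ℚ) (V : ℕ → ℤ_[2])
    (hV : ∀ j : ℕ, algebraMap ℚ_[2] (PadicAlgCl 2) (V j : ℚ_[2]) =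
      ∑ b : (ZMod (2 ^ (n + 2)))ˣ, τ (b : ZMod (2 ^ (n + 2))) • (L j * e xF))
    (q : ℚ) (c d : ℤ) (S₁ S₂ S₃ S₄ : ℚ)
    (hB2 : ∀ ψF : DirichletCharacter (CyclotomicField M ℚ) M, ψF (-1) = 1 → ψF.IsPrimitive →
      (∑ b : (ZMod M)ˣ, ψF⁻¹ (b : ZMod M) * sigma M b xF) *
          gaussSum ψF (AddChar.zmodChar M (IsCyclotomicExtension.zeta_pow M ℚ (CyclotomicField M ℚ))) =
        (q : CyclotomicField M ℚ) * ratTwistedSymbolSum f ψF *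
          ((c : CyclotomicField M ℚ) ^ 2 * (d : CyclotomicField M ℚ) ^ 2 * (S₁ : CyclotomicField M ℚ)
            - (c : CyclotomicField M ℚ) * (d : CyclotomicField M ℚ) ^ 2 * ψF (c : ZMod M) * (S₂ : CyclotomicField M ℚ)
            - (c : CyclotomicField M ℚ) ^ 2 * (d : CyclotomicField M ℚ) * ψF (d : ZMod M) * (S₃ : CyclotomicField M ℚ)
            + (c : CyclotomicField M ℚ) * (d : CyclotomicField M ℚ) * (ψF (c : ZMod M) * ψF (d : ZMod M)) *
              (S₄ : CyclotomicField M ℚ)))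
    (u : ℚ)
    (hlogprim : ∀ ψ : DirichletCharacter (PadicAlgCl 2) (2 ^ (n + 2)), ψ (-1) = 1 → ψ.IsPrimitive →
      ∑ j ∈ Finset.range (2 ^ n), ψ (5 : ZMod (2 ^ (n + 2))) ^ j * L j =
        (u : PadicAlgCl 2) * gaussSum ψ (AddChar.zmodChar (2 ^ (n + 2)) (HondaLog.zeta_pow_prime_pow_self (p := 2) (n + 2))))
    (χ : DirichletCharacter ℂ_[2] (2 ^ (n + 2))) (heven : χ (-1) = 1) (hprim : χ.IsPrimitive) :
    (q.den : ℂ_[2]) * ∑ j ∈ Finset.range (2 ^ n),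
        algebraMap (PadicAlgCl 2) ℂ_[2] (algebraMap ℚ_[2] (PadicAlgCl 2) (V j : ℚ_[2])) * χ (5 : ZMod (2 ^ (n + 2))) ^ j =
      (u : ℂ_[2]) * (q.num : ℂ_[2]) *
        ((c : ℂ_[2]) ^ 2 * (d : ℂ_[2]) ^ 2 * (S₁ : ℂ_[2]) - (c : ℂ_[2]) * (d : ℂ_[2]) ^ 2 * χ (c : ZMod (2 ^ (n + 2))) * (S₂ : ℂ_[2])
          - (c : ℂ_[2]) ^ 2 * (d : ℂ_[2]) * χ (d : ZMod (2 ^ (n + 2))) * (S₃ : ℂ_[2])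
          + (c : ℂ_[2]) * (d : ℂ_[2]) * (χ (c : ZMod (2 ^ (n + 2))) * χ (d : ZMod (2 ^ (n + 2)))) * (S₄ : ℂ_[2])) *
        ratTwistedSymbolSum f χ := by
  subst hM
  -- notation
  set ι₂ : PadicAlgCl 2 →+* ℂ_[2] := algebraMap (PadicAlgCl 2) ℂ_[2] with hι₂
  set ιQ : ℚ_[2] →+* PadicAlgCl 2 := algebraMap ℚ_[2] (PadicAlgCl 2) with hιQ
  set ζF := IsCyclotomicExtension.zeta (2 ^ (n + 2)) ℚ (CyclotomicField (2 ^ (n + 2)) ℚ) with hζFdef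
  have hζF : IsPrimitiveRoot ζF (2 ^ (n + 2)) := IsCyclotomicExtension.zeta_spec (2 ^ (n + 2)) ℚ _
  have hι₂inj : Function.Injective ι₂ := ι₂.injective
  have heinj : Function.Injective (e : CyclotomicField (2 ^ (n + 2)) ℚ →+* PadicAlgCl 2) :=
    fun a b h ↦ e.toRingHom.injective h
  haveI : NeZero (2 ^ n) := ⟨pow_ne_zero _ two_ne_zero⟩
  -- Step 1: descend `χ` to `ψ` over `ℚ̄₂` and to `ψF` over Kato's value field
  have hχpow : ∀ a : (ZMod (2 ^ (n + 2)))ˣ, χ (a : ZMod (2 ^ (n + 2))) ^ 2 ^ (n + 2) = 1 := apply_pow_two_pow_eq_one n χ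
  obtain ⟨ψ, hψ⟩ := exists_mulChar_ringHomComp_eq ι₂ hι₂inj (NeZero.pos _) (isPrimitiveRoot_zeta 2 (n + 2)) χ hχpow
  have hχa : ∀ a : ZMod (2 ^ (n + 2)), χ a = ι₂ (ψ a) := fun a ↦ by rw [← hψ, MulChar.ringHomComp_apply]
  have hψpow : ∀ a : (ZMod (2 ^ (n + 2)))ˣ, ψ (a : ZMod (2 ^ (n + 2))) ^ 2 ^ (n + 2) = 1 := fun a ↦
    hι₂inj (by rw [map_pow, ← hχa, hχpow, map_one])
  obtain ⟨ψF, hψF⟩ := exists_mulChar_ringHomComp_eq (e : CyclotomicField (2 ^ (n + 2)) ℚ →+* PadicAlgCl 2) heinj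
    (NeZero.pos _) hζF ψ hψpow
  have hψa : ∀ a : ZMod (2 ^ (n + 2)), ψ a = e (ψF a) := fun a ↦ by
    rw [← hψF, MulChar.ringHomComp_apply]; rfl
  have hevenψ : ψ (-1) = 1 := hι₂inj (by rw [← hχa, heven, map_one])
  have hevenF : ψF (-1) = 1 := heinj (by rw [RingHom.coe_coe, ← hψa, hevenψ, map_one])
  have hprimψ : DirichletCharacter.IsPrimitive ψ := by
    have h := hprim
    rw [← hψ] at h
    exact (isPrimitive_ringHomComp_iff hι₂inj ψ).mp h
  have hprimF : DirichletCharacter.IsPrimitive ψF := by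
    have h := hprimψ
    rw [← hψF] at h
    exact (isPrimitive_ringHomComp_iff heinj ψF).mp h
  -- Step 2: the `P`-side factorisation (B5a) read through (C6)
  have hE1 : ∑ j ∈ Finset.range (2 ^ n), ιQ (V j : ℚ_[2]) * ψ (5 : ZMod (2 ^ (n + 2))) ^ j =
      (∑ j ∈ Finset.range (2 ^ n), ψ (5 : ZMod (2 ^ (n + 2))) ^ j * L j) *
        ∑ b : (ZMod (2 ^ (n + 2)))ˣ, ψ⁻¹ (b : ZMod (2 ^ (n + 2))) * τ (b : ZMod (2 ^ (n + 2))) • e xF := by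
    have h1 : ∑ j ∈ Finset.range (2 ^ n), ιQ (V j : ℚ_[2]) * ψ (5 : ZMod (2 ^ (n + 2))) ^ j =
        ∑ s : ZMod (2 ^ n), ψ (5 : ZMod (2 ^ (n + 2))) ^ s.val *
          ∑ b : (ZMod (2 ^ (n + 2)))ˣ, τ (b : ZMod (2 ^ (n + 2))) • (g₀ ^ s.val • L 0 * e xF) := by
      rw [CoreChi.sum_range_eq_sum_zmod n (fun j ↦ ιQ (V j : ℚ_[2]) * ψ (5 : ZMod (2 ^ (n + 2))) ^ j)]
      refine Finset.sum_congr rfl fun s _ ↦ ?_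
      rw [hV, ← hL, mul_comm]
    have h2 : ∑ j ∈ Finset.range (2 ^ n), ψ (5 : ZMod (2 ^ (n + 2))) ^ j * L j =
        ∑ s : ZMod (2 ^ n), ψ (5 : ZMod (2 ^ (n + 2))) ^ s.val * g₀ ^ s.val • L 0 := by
      rw [CoreChi.sum_range_eq_sum_zmod n (fun j ↦ ψ (5 : ZMod (2 ^ (n + 2))) ^ j * L j)]
      refine Finset.sum_congr rfl fun s _ ↦ ?_
      rw [← hL]
    rw [h1, h2]
    exact sum_pow_mul_trace_eq_mul n τ hτ hg₀ hL0 hLneg ψ hevenψ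
  -- Step 3: the log character sum (R3-enum)
  have hE2 := hlogprim ψ hevenψ hprimψ
  -- Step 4: the `E`-side is Kato's character sum read in `ℚ̄₂`
  have hτ' : ∀ b : (ZMod (2 ^ (n + 2)))ˣ, τ (b : ZMod (2 ^ (n + 2))) • e ζF = e ζF ^ (b : ZMod (2 ^ (n + 2))).val := by
    intro b; rw [he]; exact hτ _ (Units.isUnit b)
  have hinvF : ∀ b : (ZMod (2 ^ (n + 2)))ˣ, ψ⁻¹ (b : ZMod (2 ^ (n + 2))) = e (ψF⁻¹ (b : ZMod (2 ^ (n + 2)))) := by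
    intro b
    rw [MulChar.inv_apply_eq_inv', MulChar.inv_apply_eq_inv', hψa, map_inv₀]
  have hE3 : ∑ b : (ZMod (2 ^ (n + 2)))ˣ, ψ⁻¹ (b : ZMod (2 ^ (n + 2))) * τ (b : ZMod (2 ^ (n + 2))) • e xF =
      e (∑ b : (ZMod (2 ^ (n + 2)))ˣ, ψF⁻¹ (b : ZMod (2 ^ (n + 2))) * sigma (2 ^ (n + 2)) b xF) := by
    simp_rw [hinvF]
    exact sum_mul_smul_algHom_eq e τ hτ' ψF⁻¹ xF
  -- Step 5: Kato's value law (B2) mapped along `e`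
  have hE4 := congrArg e (hB2 ψF hevenF hprimF)
  have hgauss : e (gaussSum ψF (AddChar.zmodChar (2 ^ (n + 2)) (IsCyclotomicExtension.zeta_pow (2 ^ (n + 2)) ℚ _))) =
      gaussSum ψ (AddChar.zmodChar (2 ^ (n + 2)) (HondaLog.zeta_pow_prime_pow_self (p := 2) (n + 2))) := by
    rw [gaussSum, gaussSum, map_sum]
    refine Finset.sum_congr rfl fun a _ ↦ ?_
    rw [map_mul, AddChar.zmodChar_apply, AddChar.zmodChar_apply, map_pow, ← hψa]
    change _ * e ζF ^ a.val = _
    rw [he]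
  have hRTSS : e (ratTwistedSymbolSum f ψF) = ratTwistedSymbolSum f ψ := by
    have h := ratTwistedSymbolSum_ringHomComp (e : CyclotomicField (2 ^ (n + 2)) ℚ →+* PadicAlgCl 2) f ψF
    rw [hψF] at h
    exact h.symm
  rw [map_mul, map_mul, map_mul, hgauss, hRTSS, map_ratCast] at hE4
  simp only [map_add, map_sub, map_mul, map_pow, map_intCast, map_ratCast, ← hψa] at hE4
  -- Step 6: combine in `ℚ̄₂`
  have hK : (q.den : PadicAlgCl 2) * ∑ j ∈ Finset.range (2 ^ n), ιQ (V j : ℚ_[2]) * ψ (5 : ZMod (2 ^ (n + 2))) ^ j =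
      (u : PadicAlgCl 2) * (q.num : PadicAlgCl 2) *
        ((c : PadicAlgCl 2) ^ 2 * (d : PadicAlgCl 2) ^ 2 * (S₁ : PadicAlgCl 2)
          - (c : PadicAlgCl 2) * (d : PadicAlgCl 2) ^ 2 * ψ (c : ZMod (2 ^ (n + 2))) * (S₂ : PadicAlgCl 2)
          - (c : PadicAlgCl 2) ^ 2 * (d : PadicAlgCl 2) * ψ (d : ZMod (2 ^ (n + 2))) * (S₃ : PadicAlgCl 2)
          + (c : PadicAlgCl 2) * (d : PadicAlgCl 2) * (ψ (c : ZMod (2 ^ (n + 2))) * ψ (d : ZMod (2 ^ (n + 2)))) *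
            (S₄ : PadicAlgCl 2)) * ratTwistedSymbolSum f ψ := by
    rw [hE1, hE2, hE3]
    have hq : (q.den : PadicAlgCl 2) * (q : PadicAlgCl 2) = (q.num : PadicAlgCl 2) := by
      rw [mul_comm]; exact_mod_cast Rat.mul_den_eq_num q
    -- `hE4 : e(y) * τK = q * RTSS * R`
    calc (q.den : PadicAlgCl 2) * ((u : PadicAlgCl 2) * gaussSum ψ _ * e (∑ b : (ZMod (2 ^ (n + 2)))ˣ,
            ψF⁻¹ (b : ZMod (2 ^ (n + 2))) * sigma (2 ^ (n + 2)) b xF))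
        = (u : PadicAlgCl 2) * (q.den : PadicAlgCl 2) * (e (∑ b : (ZMod (2 ^ (n + 2)))ˣ,
            ψF⁻¹ (b : ZMod (2 ^ (n + 2))) * sigma (2 ^ (n + 2)) b xF) * gaussSum ψ _) := by ring
      _ = _ := by rw [hE4, ← hq]; ring
  -- Step 7: push to `ℂ₂`
  have hfin := congrArg ι₂ hK
  simp only [map_mul, map_sum, map_pow, map_add, map_sub, map_natCast, map_intCast, map_ratCast, ← hχa] at hfin
  rw [← ratTwistedSymbolSum_ringHomComp ι₂ f ψ, hψ] at hfin
  exact hfin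

end Primitive

/-! ## §2 The per-level identity at the TRIVIAL character (base cases `n ≤ 1`), `u`-generic -/

section Trivial

/-- **The ♭ level identity at the trivial character, `u`-generic** (the base cases `n = 0, 1`; K3's `KatoBK.level_identity_trivial`
with the `{2}`-depletion factor DISPLAYED). Inputs: the (C6)-shaped pairing values, the orbit of logs with its TOTAL `Σ_{j<2ⁿ} L_j = ℓ₀`
(for the Sprung–Honda system: `2(a₂²−2a₂−1)` at `n = 0`, `2(a₂³−2a₂²−3a₂+4)` at `n = 1`), Kato's trivial-character value
`Σ_b σ_b x = (u/2)·q·[0]⁺·R_𝟙` (depleted value `L_{(2)}(f,1) = (1 − a₂/2 + 1/2)·L(f,1) = (u/2)·L(f,1)`, `u = 3 − a₂`), and the Hecke value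
`RTSS f 𝟙 = h₀·[0]⁺` (`(a₂²−2a₂−1)[0]⁺` at level 4, `(a₂³−2a₂²−3a₂+4)[0]⁺` at level 8), tied by `ℓ₀ = 2h₀`. Conclusion:
`q.den · Σ_j V_j = u · q.num · R · ratTwistedSymbolSum f 1`.
[cite: Kobayashi2003, Prop. 8.25 (p. 24)] [cite: Kato2004Asterisque, Thm. 6.6 (1), Thm. 9.7] [cite: MazurTateTeitelbaum1986Invent, §I.4 (4.2)]
[cite: Sprung2012, Thm. 2.2, Lemma 2.3] -/
theorem flat_level_identity_trivial {N : ℕ} [NeZero N] (f : CuspForm (Gamma0 N) 2)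
    (n : ℕ) {M : ℕ} [NeZero M] (hM : M = 2 ^ (n + 2))
    (e : CyclotomicField M ℚ →ₐ[ℚ] PadicAlgCl 2)
    (he : e (IsCyclotomicExtension.zeta M ℚ (CyclotomicField M ℚ)) = zeta 2 (n + 2))
    (τ : ZMod (2 ^ (n + 2)) → Field.absoluteGaloisGroup ℚ_[2])
    (hτ : ∀ a : ZMod (2 ^ (n + 2)), IsUnit a → τ a • zeta 2 (n + 2) = zeta 2 (n + 2) ^ a.val)
    {g₀ : Field.absoluteGaloisGroup ℚ_[2]} (hg₀ : ∀ j : ℕ, g₀ ^ j • zeta 2 (n + 2) = zeta 2 (n + 2) ^ 5 ^ j)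
    (L : ℕ → PadicAlgCl 2) (hL : ∀ j, L j = g₀ ^ j • L 0) (hL0 : L 0 ∈ layer 2 (n + 2))
    (hLneg : ∀ a : ZMod (2 ^ (n + 2)), IsUnit a → τ (-a) • L 0 = τ a • L 0)
    (xF : CyclotomicField M ℚ) (V : ℕ → ℤ_[2])
    (hV : ∀ j : ℕ, algebraMap ℚ_[2] (PadicAlgCl 2) (V j : ℚ_[2]) =
      ∑ b : (ZMod (2 ^ (n + 2)))ˣ, τ (b : ZMod (2 ^ (n + 2))) • (L j * e xF))
    (q : ℚ) (c d : ℤ) (hc : IsUnit (c : ZMod (2 ^ (n + 2)))) (hd : IsUnit (d : ZMod (2 ^ (n + 2))))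
    (S₀ S₁ S₂ S₃ S₄ ℓ₀ h₀ u : ℚ) (hrel : ℓ₀ = 2 * h₀)
    (hlog : ∑ j ∈ Finset.range (2 ^ n), L j = (ℓ₀ : PadicAlgCl 2))
    (hB4c : ∑ b : (ZMod M)ˣ, sigma M b xF =
      ((u / 2 * q * S₀ * (c ^ 2 * d ^ 2 * S₁ - c * d ^ 2 * S₂ - c ^ 2 * d * S₃ + c * d * S₄) : ℚ) : CyclotomicField M ℚ))
    (hH : ratTwistedSymbolSum f (1 : DirichletCharacter ℂ_[2] (2 ^ (n + 2))) = ((h₀ * S₀ : ℚ) : ℂ_[2])) :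
    (q.den : ℂ_[2]) * ∑ j ∈ Finset.range (2 ^ n),
        algebraMap (PadicAlgCl 2) ℂ_[2] (algebraMap ℚ_[2] (PadicAlgCl 2) (V j : ℚ_[2])) *
          (1 : DirichletCharacter ℂ_[2] (2 ^ (n + 2))) (5 : ZMod (2 ^ (n + 2))) ^ j =
      (u : ℂ_[2]) * (q.num : ℂ_[2]) *
        ((c : ℂ_[2]) ^ 2 * (d : ℂ_[2]) ^ 2 * (S₁ : ℂ_[2])
          - (c : ℂ_[2]) * (d : ℂ_[2]) ^ 2 * (1 : DirichletCharacter ℂ_[2] (2 ^ (n + 2))) (c : ZMod (2 ^ (n + 2))) * (S₂ : ℂ_[2])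
          - (c : ℂ_[2]) ^ 2 * (d : ℂ_[2]) * (1 : DirichletCharacter ℂ_[2] (2 ^ (n + 2))) (d : ZMod (2 ^ (n + 2))) * (S₃ : ℂ_[2])
          + (c : ℂ_[2]) * (d : ℂ_[2]) * ((1 : DirichletCharacter ℂ_[2] (2 ^ (n + 2))) (c : ZMod (2 ^ (n + 2))) *
              (1 : DirichletCharacter ℂ_[2] (2 ^ (n + 2))) (d : ZMod (2 ^ (n + 2)))) * (S₄ : ℂ_[2])) *
        ratTwistedSymbolSum f (1 : DirichletCharacter ℂ_[2] (2 ^ (n + 2))) := by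
  subst hM
  set ι₂ : PadicAlgCl 2 →+* ℂ_[2] := algebraMap (PadicAlgCl 2) ℂ_[2] with hι₂
  set ιQ : ℚ_[2] →+* PadicAlgCl 2 := algebraMap ℚ_[2] (PadicAlgCl 2) with hιQ
  set ζF := IsCyclotomicExtension.zeta (2 ^ (n + 2)) ℚ (CyclotomicField (2 ^ (n + 2)) ℚ) with hζFdef
  haveI : NeZero (2 ^ n) := ⟨pow_ne_zero _ two_ne_zero⟩
  have h5 : IsUnit (5 : ZMod (2 ^ (n + 2))) := by
    have h := isUnit_five_pow (n + 2) 1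
    rwa [pow_one] at h
  -- the trivial characters evaluate to `1` on units
  have h1C : ∀ {a : ZMod (2 ^ (n + 2))}, IsUnit a → (1 : DirichletCharacter ℂ_[2] (2 ^ (n + 2))) a = 1 :=
    fun ha ↦ MulChar.one_apply ha
  have h1K : ∀ {a : ZMod (2 ^ (n + 2))}, IsUnit a → (1 : DirichletCharacter (PadicAlgCl 2) (2 ^ (n + 2))) a = 1 :=
    fun ha ↦ MulChar.one_apply ha
  rw [h1C h5, h1C hc, h1C hd, hH]
  simp only [one_pow, mul_one]
  -- Step 1: factorisation with `ψ = 1`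
  have hE1 : ∑ j ∈ Finset.range (2 ^ n), ιQ (V j : ℚ_[2]) =
      (∑ j ∈ Finset.range (2 ^ n), L j) *
        ∑ b : (ZMod (2 ^ (n + 2)))ˣ, τ (b : ZMod (2 ^ (n + 2))) • e xF := by
    have hfac := sum_pow_mul_trace_eq_mul n τ hτ hg₀ (E := e xF) hL0 hLneg
      (1 : DirichletCharacter (PadicAlgCl 2) (2 ^ (n + 2))) (h1K (by rw [IsUnit.neg_iff]; exact isUnit_one))
    rw [h1K h5, inv_one] at hfac
    simp only [one_pow, one_mul] at hfac
    have h1 : ∑ j ∈ Finset.range (2 ^ n), ιQ (V j : ℚ_[2]) =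
        ∑ s : ZMod (2 ^ n), ∑ b : (ZMod (2 ^ (n + 2)))ˣ, τ (b : ZMod (2 ^ (n + 2))) • (g₀ ^ s.val • L 0 * e xF) := by
      rw [CoreChi.sum_range_eq_sum_zmod n (fun j ↦ ιQ (V j : ℚ_[2]))]
      refine Finset.sum_congr rfl fun s _ ↦ ?_
      rw [hV, ← hL]
    have h2 : ∑ j ∈ Finset.range (2 ^ n), L j = ∑ s : ZMod (2 ^ n), g₀ ^ s.val • L 0 := by
      rw [CoreChi.sum_range_eq_sum_zmod n (fun j ↦ L j)]
      refine Finset.sum_congr rfl fun s _ ↦ ?_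
      rw [← hL]
    have h3 : ∑ b : (ZMod (2 ^ (n + 2)))ˣ, τ (b : ZMod (2 ^ (n + 2))) • e xF =
        ∑ b : (ZMod (2 ^ (n + 2)))ˣ, (1 : DirichletCharacter (PadicAlgCl 2) (2 ^ (n + 2))) (b : ZMod (2 ^ (n + 2))) *
          τ (b : ZMod (2 ^ (n + 2))) • e xF := by
      refine Finset.sum_congr rfl fun b _ ↦ ?_
      rw [h1K (Units.isUnit b), one_mul]
    rw [h1, h2, h3]
    exact hfac
  -- Step 2: the `E`-side is the trivial character sum of Kato, read in `ℚ̄₂`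
  have hτ' : ∀ b : (ZMod (2 ^ (n + 2)))ˣ, τ (b : ZMod (2 ^ (n + 2))) • e ζF = e ζF ^ (b : ZMod (2 ^ (n + 2))).val := by
    intro b; rw [he]; exact hτ _ (Units.isUnit b)
  have hE3 : ∑ b : (ZMod (2 ^ (n + 2)))ˣ, τ (b : ZMod (2 ^ (n + 2))) • e xF =
      e (∑ b : (ZMod (2 ^ (n + 2)))ˣ, sigma (2 ^ (n + 2)) b xF) := by
    have h := sum_mul_smul_algHom_eq e τ hτ' (1 : MulChar (ZMod (2 ^ (n + 2))) (CyclotomicField (2 ^ (n + 2)) ℚ)) xF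
    have hr : ∀ b : (ZMod (2 ^ (n + 2)))ˣ,
        (1 : MulChar (ZMod (2 ^ (n + 2))) (CyclotomicField (2 ^ (n + 2)) ℚ)) (b : ZMod (2 ^ (n + 2))) = 1 := fun b ↦
      MulChar.one_apply (Units.isUnit b)
    simp only [hr, map_one, one_mul] at h
    exact h
  -- Step 3: combine in `ℚ̄₂`, then push to `ℂ₂`
  have hK : (q.den : PadicAlgCl 2) * ∑ j ∈ Finset.range (2 ^ n), ιQ (V j : ℚ_[2]) =
      (u : PadicAlgCl 2) * (q.num : PadicAlgCl 2) *
        ((c : PadicAlgCl 2) ^ 2 * (d : PadicAlgCl 2) ^ 2 * (S₁ : PadicAlgCl 2)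
          - (c : PadicAlgCl 2) * (d : PadicAlgCl 2) ^ 2 * (S₂ : PadicAlgCl 2)
          - (c : PadicAlgCl 2) ^ 2 * (d : PadicAlgCl 2) * (S₃ : PadicAlgCl 2)
          + (c : PadicAlgCl 2) * (d : PadicAlgCl 2) * (S₄ : PadicAlgCl 2)) * ((h₀ * S₀ : ℚ) : PadicAlgCl 2) := by
    rw [hE1, hE3, hB4c, map_ratCast, hlog, hrel]
    have hq : (q.den : PadicAlgCl 2) * (q : PadicAlgCl 2) = (q.num : PadicAlgCl 2) := by
      rw [mul_comm]; exact_mod_cast Rat.mul_den_eq_num q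
    push_cast
    rw [← hq]
    ring
  have hfin := congrArg ι₂ hK
  simp only [map_mul, map_sum, map_pow, map_add, map_sub, map_natCast, map_intCast, map_ratCast] at hfin
  exact hfin

end Trivial

end Summit.BirchSwinnertonDyer.BirchSwinnertonDyer.Theorems.SSFlatERL

end
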